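import Summits.Parity.BatemanHorn.Theses.RoughValueTransport
import Summits.Parity.BatemanHorn.Theorems.BalancedSemiprimeLayer.Negative.NatDegreePos
import Literature.NumberTheory.Sieve.BuchstabLimitFact
import Literature.NumberTheory.Sieve.BatemanHornProofs

/-!
# `BalancedSemiprimeLayer` (crux stmt-Parity-9469): relative consistency — no refutation without refuting `RoughValueLaw`, `SieveCalibration` or Bateman–Horn

Negative-side META-RESULT (cdisprove, refuter-cdisprove-stmt-Parity-9469-g2-0), PROVED: the crux's
conclusion for every Bateman–Horn system FOLLOWS from the route's other crux `RoughValueLaw`, its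
provable-now support item `SieveCalibration`, and the summit statement `BatemanHorn` itself
(`cruxConclusion_of_roughValueLaw_of_sieveCalibration_of_batemanHorn`). This is the converse of the
route's Assembly (`RoughValueLaw → BalancedSemiprimeLayer → SieveCalibration → BatemanHorn`):
modulo `RoughValueLaw ∧ SieveCalibration` the crux is EQUIVALENT to Bateman–Horn ("the lower half of
BH"), so

* a refutation of `BalancedSemiprimeLayer` would refute `RoughValueLaw ∨ SieveCalibration ∨ BatemanHorn`
  — i.e. (SieveCalibration being a fundamental-lemma exercise) it would be an ANTI-Bateman–Horn
  phenomenon or a failure of the Buchstab shape of rough values: the crux carries no risk of its own;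
* conversely the crux cannot be cheaper than "BH given RoughValueLaw": any proof is Bateman–Horn-strength
  information about the boundary layer `u ↓ 2`.

Proof: instantiate `RoughValueLaw` at `ω = buchstabOmega` (it satisfies the inline predicate by the
tree's `buchstabOmega_eq_inv`, `continuousOn_buchstabOmega`, `hasDerivAt_mul_buchstabOmega`) to get
`A` with `Φ_f(x,u)(log x)^k/x → A(uω(u))^k`; `SieveCalibration` with `L(u) = A(uω(u))^k` and the PROVED
Buchstab limit `harman2007_buchstabOmega_tendsto_holds` (`ω → e^{−γ}`) force `A = C(f)/∏deg fᵢ`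
(limits are unique, `e^{−kγ} ≠ 0`); Bateman–Horn gives `P_f(x)(log x)^k/x → C(f)/∏deg fᵢ` (the
Euler-product constant is unique: `IsBatemanHornSystem.hasBatemanHornConst_holds`); at `u = 2/(1−δ)`
the crux's count IS `Φ_f(x,u)` (same real exponent `deg fᵢ(1−δ)/2 = deg fᵢ/u`), so the layer is
`∼ (C(f)/∏deg)·[(1 + log((1+δ)/(1−δ)))^k − 1]·x/(log x)^k` (`buchstabOmega_eq_of_mem_Icc_two_three`),
and the bracket `→ 0` as `δ → 0` (continuity), whence `δ(ε)`.
-/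

namespace Summit.Parity.BatemanHorn.Theorems.BalancedSemiprimeLayer.Negative

open Filter Finset Polynomial Real Asymptotics
open scoped Topology
open Literature.NumberTheory.Sieve
open Summit.Parity.BatemanHorn.Theses.RoughValueTransport

/-- **Relative consistency of the crux**: `RoughValueLaw`, `SieveCalibration` and `BatemanHorn`
together imply the conclusion of `BalancedSemiprimeLayer` for every Bateman–Horn system (hence the
crux itself; stated per system to keep the obligation graph clean). [folklore] -/
theorem cruxConclusion_of_roughValueLaw_of_sieveCalibration_of_batemanHorn
    (hR : RoughValueLaw) (hS : SieveCalibration) (hB : _root_.BatemanHorn)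
    {k : ℕ} (f : Fin k → ℤ[X]) (hf : IsBatemanHornSystem f) (ε : ℝ) (hε : 0 < ε) :
    ∃ δ : ℝ, 0 < δ ∧ δ ≤ 1 / 4 ∧ ∀ᶠ x : ℕ in atTop,
      (((Icc 1 x).filter (fun n : ℕ => ∀ i, 0 < (f i).eval (n : ℤ) ∧
        ∀ p ∈ range ⌈(x : ℝ) ^ (((f i).natDegree : ℝ) * (1 - δ) / 2)⌉₊,
          p.Prime → ¬ ((p : ℤ) ∣ (f i).eval (n : ℤ)))).card : ℝ) ≤
        (polyPrimeCount f x : ℝ) + ε * (x : ℝ) / Real.log x ^ k := by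
  -- the constants `C(f)`, `D = ∏ deg fᵢ > 0`
  have hD0 : (0 : ℝ) < ∏ i, ((f i).natDegree : ℝ) :=
    prod_pos fun i _ => by exact_mod_cast natDegree_pos_of_isBatemanHornSystem hf i
  obtain ⟨hconst, hCf0⟩ := IsBatemanHornSystem.hasBatemanHornConst_holds hf
  -- Step 1: `ω = buchstabOmega` satisfies the inline predicate; `A` from RoughValueLaw
  obtain ⟨A, hA⟩ := hR k f hf buchstabOmega
    ⟨fun u h1 h2 => buchstabOmega_eq_inv h1 h2, continuousOn_buchstabOmega,
      fun u hu => hasDerivAt_mul_buchstabOmega hu⟩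
  -- Step 2: SieveCalibration with `L u = A (u ω u)^k`
  have hSC := hS k f hf (fun u => A * (u * buchstabOmega u) ^ k) ⟨3, fun u hu => hA u (by linarith)⟩
  -- Step 3: the same ratio tends to `A e^{-kγ}` (de Bruijn's limit, PROVED in the tree)
  have hω := harman2007_buchstabOmega_tendsto_holds
  unfold harman2007_buchstabOmega_tendsto at hω
  have hSC' : Tendsto (fun u : ℝ => A * (u * buchstabOmega u) ^ k / u ^ k) atTop
      (𝓝 (A * Real.exp (-Real.eulerMascheroniConstant) ^ k)) := by
    have h1 := (hω.pow k).const_mul A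
    refine h1.congr' ?_
    filter_upwards [eventually_gt_atTop 0] with u hu
    rw [mul_pow]
    field_simp
  have hAeq : A = batemanHornConst f / ∏ i, ((f i).natDegree : ℝ) := by
    have huniq := tendsto_nhds_unique hSC' hSC
    have he : Real.exp (-((k : ℝ) * Real.eulerMascheroniConstant)) =
        Real.exp (-Real.eulerMascheroniConstant) ^ k := by
      rw [← Real.exp_nat_mul]
      congr 1
      ring
    rw [he] at huniq
    exact mul_right_cancel₀ (pow_ne_zero k (Real.exp_pos _).ne') huniq
  -- Step 4: Bateman–Horn ⇒ `P_f(x)(log x)^k/x → C(f)/D`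
  obtain ⟨C, hC, hPequiv⟩ := hB k f hf
  have hCeq : C = batemanHornConst f := tendsto_nhds_unique hC hconst
  rw [Fintype.card_fin, hCeq] at hPequiv
  have hv : ∀ᶠ x : ℕ in atTop,
      batemanHornConst f / (∏ i, ((f i).natDegree : ℝ)) * (x : ℝ) / Real.log x ^ k ≠ 0 := by
    filter_upwards [eventually_gt_atTop 1] with x hx
    have hx' : (1 : ℝ) < x := by exact_mod_cast hx
    have : 0 < Real.log x := Real.log_pos hx'
    positivity
  have hP1 := (isEquivalent_iff_tendsto_one hv).mp hPequiv
  have hP : Tendsto (fun x : ℕ => (polyPrimeCount f x : ℝ) * Real.log x ^ k / x) atTop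
      (𝓝 (batemanHornConst f / ∏ i, ((f i).natDegree : ℝ))) := by
    have h2 := hP1.const_mul (batemanHornConst f / ∏ i, ((f i).natDegree : ℝ))
    rw [mul_one] at h2
    refine h2.congr' ?_
    filter_upwards [eventually_gt_atTop 1] with x hx
    have hx' : (1 : ℝ) < x := by exact_mod_cast hx
    have hlog : 0 < Real.log x := Real.log_pos hx'
    have hx0 : (0 : ℝ) < x := by linarith
    simp only [Pi.div_apply]
    field_simp
  -- Step 5: choose `δ` by continuity of `δ ↦ C₀((1 + log((1+δ)/(1−δ)))^k − 1)` at `0`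
  have hφc : ContinuousAt (fun δ : ℝ => batemanHornConst f / (∏ i, ((f i).natDegree : ℝ)) *
      ((1 + Real.log ((1 + δ) / (1 - δ))) ^ k - 1)) 0 := by
    fun_prop (disch := norm_num)
  have hevφ : ∀ᶠ δ : ℝ in 𝓝 0, batemanHornConst f / (∏ i, ((f i).natDegree : ℝ)) *
      ((1 + Real.log ((1 + δ) / (1 - δ))) ^ k - 1) < ε := by
    have := hφc.tendsto
    simp only [add_zero, sub_zero, div_one, Real.log_one, one_pow, sub_self, mul_zero] at this
    exact this.eventually (eventually_lt_nhds hε)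
  obtain ⟨r, hr, hrφ⟩ := Metric.eventually_nhds_iff.mp hevφ
  refine ⟨min (1 / 4) (r / 2), by positivity, min_le_left _ _, ?_⟩
  set δ : ℝ := min (1 / 4) (r / 2) with hδ_def
  have hδ0 : 0 < δ := by positivity
  have hδ4 : δ ≤ 1 / 4 := min_le_left _ _
  have hδr : δ < r := lt_of_le_of_lt (min_le_right _ _) (by linarith)
  have hφδ : batemanHornConst f / (∏ i, ((f i).natDegree : ℝ)) *
      ((1 + Real.log ((1 + δ) / (1 - δ))) ^ k - 1) < ε :=
    hrφ (by rw [Real.dist_eq, sub_zero, abs_of_pos hδ0]; exact hδr)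
  -- Step 6: at `u = 2/(1−δ)` the crux count is `Φ_f(x, u)`
  set u : ℝ := 2 / (1 - δ) with hu_def
  have h1δ : 0 < 1 - δ := by linarith
  have hu2 : 2 < u := by
    rw [hu_def, lt_div_iff₀ h1δ]; linarith
  have hu3 : u ≤ 3 := by
    rw [hu_def, div_le_iff₀ h1δ]; linarith
  have hexp : ∀ d : ℕ, (d : ℝ) / u = (d : ℝ) * (1 - δ) / 2 := by
    intro d
    rw [hu_def]
    field_simp
  have hcount : ∀ x : ℕ, #((Icc 1 x).filter (fun n : ℕ => ∀ i, 0 < (f i).eval (n : ℤ) ∧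
        ∀ p ∈ range ⌈(x : ℝ) ^ (((f i).natDegree : ℝ) / u)⌉₊,
          p.Prime → ¬ ((p : ℤ) ∣ (f i).eval (n : ℤ)))) =
      #((Icc 1 x).filter (fun n : ℕ => ∀ i, 0 < (f i).eval (n : ℤ) ∧
        ∀ p ∈ range ⌈(x : ℝ) ^ (((f i).natDegree : ℝ) * (1 - δ) / 2)⌉₊,
          p.Prime → ¬ ((p : ℤ) ∣ (f i).eval (n : ℤ)))) := by
    intro x
    congr 1
    ext n
    simp only [mem_filter, hexp]
  have hAu' : Tendsto (fun x : ℕ => (#((Icc 1 x).filter (fun n : ℕ => ∀ i, 0 < (f i).eval (n : ℤ) ∧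
        ∀ p ∈ range ⌈(x : ℝ) ^ (((f i).natDegree : ℝ) * (1 - δ) / 2)⌉₊,
          p.Prime → ¬ ((p : ℤ) ∣ (f i).eval (n : ℤ)))) : ℝ) * Real.log x ^ k / x) atTop
      (𝓝 (A * (u * buchstabOmega u) ^ k)) := by
    refine (hA u hu2).congr' (Eventually.of_forall fun x => ?_)
    rw [hcount x]
  -- value of the rough-value limit at `u`: `A (uω(u))^k = C₀ (1 + log((1+δ)/(1−δ)))^k`
  have hval : A * (u * buchstabOmega u) ^ k = batemanHornConst f / (∏ i, ((f i).natDegree : ℝ)) *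
      (1 + Real.log ((1 + δ) / (1 - δ))) ^ k := by
    rw [hAeq, buchstabOmega_eq_of_mem_Icc_two_three hu2.le hu3]
    have hu0 : u ≠ 0 := by linarith
    have h1 : u - 1 = (1 + δ) / (1 - δ) := by
      rw [hu_def]
      field_simp
      ring
    rw [mul_div_cancel₀ _ hu0, h1]
  rw [hval] at hAu'
  -- Step 7: the layer limit is `< ε`; unfold the eventual inequality
  have hlayer := hAu'.sub hP
  rw [← mul_sub_one] at hlayer
  filter_upwards [hlayer.eventually (eventually_lt_nhds hφδ), eventually_gt_atTop 1] with x hx hx1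
  have hx' : (1 : ℝ) < x := by exact_mod_cast hx1
  have hlog : 0 < Real.log x := Real.log_pos hx'
  have hx0 : (0 : ℝ) < x := by linarith
  have hpow : 0 < Real.log x ^ k := pow_pos hlog k
  rw [← sub_div, ← sub_mul, div_lt_iff₀ hx0] at hx
  have key : ∀ a b : ℝ, (a - b) * Real.log x ^ k < ε * x → a ≤ b + ε * x / Real.log x ^ k := by
    intro a b hab
    have : a - b ≤ ε * x / Real.log x ^ k := by
      rw [le_div_iff₀ hpow]
      exact hab.le
    linarith
  exact key _ _ hx

end Summit.Parity.BatemanHorn.Theorems.BalancedSemiprimeLayer.Negative
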